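import Summits.BirchSwinnertonDyer.BirchSwinnertonDyer.Theorems.ByReductionTypeAtTwoTowerNoFiniteSubmoduleOfCorankBounded
import Summits.BirchSwinnertonDyer.Rank1Residual.P2.EmptyCellsAtTwo
import Summits.BirchSwinnertonDyer.Rank1Residual.X5.RationalTwoTorsionPoints
import Literature.NumberTheory.EllipticCurves.PAdicBSD
import HarnessLib

/-!
# Route `ByReductionTypeAtTwo` (rung K4), crux `SupersingularRankZeroAtTwo` (item stmt-BirchSwinnertonDyer-19097), line
# `odd_blind_package` v2.11/v2.12′, slot 4 `stub_NFflat` — HAND h11 «CLASSICAL NF AT GOOD SUPERSINGULAR 2»: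
# `X(E/ℚ_∞)` (the CLASSICAL `2^∞`-Selmer dual over the cyclotomic `ℤ₂`-tower, any key `γ`) has NO non-zero FINITE `Λ`-submodule for
# `E/ℚ` with good supersingular reduction at `2` — Hachimori–Matsuno / Matsuno 2003 Prop. 4.1 / Kitajima–Otsuki Thm. 4.5 at `p = 2`,
# modulo the two PRINT inputs displayed as leading binders: (hCT) the Cassels–Tate layer pairing (Literature named fact, by name) and
# (hKR) «`corank_{ℤ₂} Sel_{2^∞}(E/ℚ_n)` bounded along the cyclotomic tower» (Kato 2004 Thm. 14.2 + Rohrlich 1984; not in the tree)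

HONEST FRAMING (cell `bsd-2adic`, run/shared/lean/pub/bsd-2adic/, seat `bsd-2adic-tower-1` GEN 63 on the pen GEN 39 SUMMON «HAND h11»;
LEAD ss-1 GEN 23 memo `ss/gen23/HAND-TARGETS-NF-1.md` §1; HUMAN RULINGS D-0036 / D-0054 / D-0074): THEOREMS ONLY (no definition, no named
fact, no instance, no `sorry`; axioms the standard trio); `--supports stmt-BirchSwinnertonDyer-19097` helper. The memo's target
`classicalNoFiniteSubmodule_goodSS_two : ∀ W …, GoodSS W 2 → ∀ κ γ, … → ∀ S [Module.Finite Λ S.X], ∀ N, Finite N → N = ⊥` (= binder `hA`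
of ★★ p822368 `OddBlindNF.flatNoFiniteSubmoduleAtTwo_of_classical` / ★★ p822496 `…_of_classical_of_kernelCyclic`) is proved here WITH TWO
LEADING HYPOTHESIS BINDERS in front of the verbatim signature (`stub-misstated` in the hand's reply grammar — the LEAD re-types slot 4's
`hA` accordingly): neither print input is a tree theorem (`_holds` pass of record: the Cassels–Tate pairing is not constructed in the
tree — `WeierstrassCurve.exists_casselsTate_pairing` and `HachimoriMatsuno2000.casselsTate_layerPairing` are statement-only facts; no
`selmerCorank`/`zpCorank` statement over the LAYERS `ℚ_n` exists, Rohrlich's theorem is present only as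
`Rohrlich1984_nonvanishing_twists`). NF♭ (slot 4) is NOT closed by this alone ((hC) = h13 open); 19097 OPEN; nothing booked; BSD is proved
for no curve by any of this. bears_on: K4 (19097; TOWER road 19271 by method).

WHAT IT PROVES, and why the torsion-free road is needed. At a good SUPERSINGULAR prime `X(E/ℚ_∞)` is NOT `Λ`-torsion (Greenberg LNM 1716
Thm. 1.7 = tree theorem `InputsGreenbergRelaxedCount.not_isTorsion_of_supersingular`, cf. `OddBlindNF.exists_nonTorsion_classical_of_goodSS_two`),
so Greenberg's Prop. 4.14/4.15 and the torsion form of Hachimori–Matsuno (this seat's GEN 21/22 `TowerHaMa.…OfCasselsTate*`, cell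
`bsd-potss`' `forall_finite_eq_bot_of_selfDualLayers_of_isTorsion`) do not apply. Hachimori–Matsuno's proof uses torsion ONLY to bound the
`ℤ_p`-coranks of the divisible parts `D_n ⊆ Sel_{p^∞}(E/K_n)` (p. 2540 L40–42); the sibling file `…TowerNoFiniteSubmoduleOfCorankBounded`
(this GEN) re-keys the whole road on that bound (`TowerHaMa.SelmerDualData.forall_finite_eq_bot_of_casselsTateLayerPairing_of_corankBounded`,
ANY `K`, `p`, `κ`, `γ`, `E(K)[p] = 0`). HERE, for `E/ℚ` globally minimal, good supersingular at `2`, `κ` cyclotomic with topological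
generator `γ` (the `IsCyclotomicVariable` binder is carried, unused) and ANY dual datum `S` (finite generation carried, unused):
`E(ℚ)[2] = 0` is AUTOMATIC (`Ẽ(𝔽₂)` has odd order: tree theorems `P2.irr_two_of_goodSS_two` + `X5.O1.irr_two_iff_forall_two_nsmul`), so

* `classicalNoFiniteSubmodule_of_goodSS_two_of_casselsTateLayerPairing_of_corankBounded` — per curve / tower: (hCT) + `GoodSS W 2` +
  `∃ B, ∀ n, zpCorank (Sel_{2^∞}(E/ℚ_n)) 2 ≤ B` ⟹ every `S : W.SelmerDualData κ γ` has no non-zero finite `Λ`-submodule;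
* ★★ `classicalNoFiniteSubmodule_goodSS_two_of_casselsTateLayerPairing_of_corankBounded (hCT) (hKR) : ‹memo §1 signature VERBATIM›` —
  the hand, with (hKR) = «for every globally minimal elliptic `W/ℚ` good supersingular at `2` and every CYCLOTOMIC `κ`,
  `∃ B, ∀ n, zpCorank (W.selmerLayer κ n) 2 ≤ B`» (Kato 2004 Thm. 14.2 (2) / Cor. 14.3 + Rohrlich 1984: the `χ`-parts of `Sel_{2^∞}(E/ℚ_n)` for
  the cofinitely many characters `χ` of `Gal(ℚ_∞/ℚ)` with `L(E, χ, 1) ≠ 0` are finite, so the corank is carried by finitely many exceptional `χ` and is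
  bounded by `corank Sel_{2^∞}(E/ℚ_{n₀})` for their common level `n₀` — in print for every modular `E/ℚ`, any finite place, no parity proviso; NOT the
  (unknown) finiteness of `Ш(E/ℚ_n)[2^∞]`);
* `classicalNoFiniteSubmodule_goodSS_two_of_casselsTateLayerPairing_of_stationary (hCT) (hST)` — the same with the weakest growth input,
  the STATIONARITY of `res_∞(Sel_{2^∞}(E/ℚ_n)_{div})` in `H¹(ℚ_∞, E[2^∞])`, displayed instead of the corank bound.

References: [HachimoriMatsuno2000] Theorem, Cor. (i), proof p. 2540 L28–L45; [Matsuno2003] J. Number Theory 99 (2003), Prop. 4.1;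
[KitajimaOtsuki2018] Prop. 4.4, Thm. 4.5 (arXiv:1607.03612 p. 18); [GreenbergLNM1716] Thm. 1.7, Prop. 4.14/4.15 (pp. 104–105);
[Kato2004Asterisque] Thm. 14.2, Cor. 14.3 (pp. 235–236); [Rohrlich1984Invent] Theorem; [MilneADT2006] I Thm. 6.13, Rem. 6.10;
[SilvermanAEC2009] Thm. X.4.14.
-/

set_option autoImplicit false
-- the Theorems namespace of this sub repeats the summit name by design (D-0017 nested layout)
set_option linter.dupNamespace false

noncomputable section

open scoped Classical NumberField
open NumberField IsDedekindDomain WeierstrassCurve Literature.NumberTheory.EllipticCurves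
  Literature.NumberTheory.EllipticCurves.Rank1Residual Literature.NumberTheory.EllipticCurves.IwasawaDual
  Literature.NumberTheory.GaloisRepresentations
  ZpExtension Summit.BirchSwinnertonDyer.Rank1Residual

namespace Summit.BirchSwinnertonDyer.BirchSwinnertonDyer.Theorems

namespace OddBlindNF

/-! ### §1 Per curve / per tower -/

/-- **Classical NF at good supersingular `2`, per curve and tower, modulo the two print inputs.** For `E = W/ℚ` elliptic, globally
minimal, good supersingular at `2` (`GoodSS W 2`), ANY `ℤ₂`-extension `κ` with topological generator `γ`, ANY dual datum
`S : W.SelmerDualData κ γ`: granted the Literature named fact `HachimoriMatsuno2000.casselsTate_layerPairing` (hCT) and a bound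
`∃ B, ∀ n, corank_{ℤ₂} Sel_{2^∞}(E/ℚ_n) ≤ B` (hB, the tree's `zpCorank`), `S.X = X(E/ℚ_∞)` has no non-zero finite `Λ`-submodule. Kernel:
`E(ℚ)[2] = 0` at good supersingular `2` (`P2.irr_two_of_goodSS_two`, `X5.O1.irr_two_iff_forall_two_nsmul`) feeds
`TowerHaMa.SelmerDualData.forall_finite_eq_bot_of_casselsTateLayerPairing_of_corankBounded` (Hachimori–Matsuno with bounded corank in place
of torsion). [cite: HachimoriMatsuno2000, Theorem and Corollary (i), proof p. 2540 L28–L45] [cite: Matsuno2003, Prop. 4.1]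
[cite: KitajimaOtsuki2018, Thm. 4.5 (arXiv:1607.03612 p. 18)] -/
theorem classicalNoFiniteSubmodule_of_goodSS_two_of_casselsTateLayerPairing_of_corankBounded
    (hCT : HachimoriMatsuno2000.casselsTate_layerPairing.{0})
    (W : WeierstrassCurve ℚ) [W.IsElliptic] [W.IsGloballyMinimal] (hss : GoodSS W 2)
    (κ : ZpExtension ℚ 2) (γ : Field.absoluteGaloisGroup ℚ) (hγ : κ.IsTopGenerator γ)
    (hB : ∃ B : ℕ, ∀ n : ℕ, zpCorank (W.selmerLayer κ n) 2 ≤ B) (S : W.SelmerDualData κ γ) :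
    ∀ N : Submodule (IwasawaAlgebra 2) S.X, Finite N → N = ⊥ :=
  -- `E(ℚ)[2] = 0` at good supersingular `2` (the `DecidableEq ℚ` instances of the two point groups are bridged by `convert`)
  TowerHaMa.SelmerDualData.forall_finite_eq_bot_of_casselsTateLayerPairing_of_corankBounded W κ hCT hγ
    (fun P hP ↦ (X5.O1.irr_two_iff_forall_two_nsmul W).mp (P2.irr_two_of_goodSS_two W hss) P (by convert hP)) S hB

/-- **The same with the STATIONARITY of the divisible parts displayed** (the weakest growth input: the images of
`Sel_{2^∞}(E/ℚ_{n+1})_{div}` and `Sel_{2^∞}(E/ℚ_n)_{div}` in `H¹(ℚ_∞, E[2^∞])` agree for `n ≥ m`).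
[cite: HachimoriMatsuno2000, Theorem and Corollary (i), proof p. 2540 L28–L45] -/
theorem classicalNoFiniteSubmodule_of_goodSS_two_of_casselsTateLayerPairing_of_stationary
    (hCT : HachimoriMatsuno2000.casselsTate_layerPairing.{0})
    (W : WeierstrassCurve ℚ) [W.IsElliptic] [W.IsGloballyMinimal] (hss : GoodSS W 2)
    (κ : ZpExtension ℚ 2) (γ : Field.absoluteGaloisGroup ℚ) (hγ : κ.IsTopGenerator γ)
    (hst : ∃ m : ℕ, ∀ n, m ≤ n → ∀ d ∈ AddSubgroup.divisibleElements (W.selmerLayer κ (n + 1)),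
      ∃ d₀ ∈ AddSubgroup.divisibleElements (W.selmerLayer κ n),
        W.layerToInfty κ (n + 1) (d : W.subgroupH1 2 (κ.layerSubgroup (n + 1))) = W.layerToInfty κ n d₀)
    (S : W.SelmerDualData κ γ) :
    ∀ N : Submodule (IwasawaAlgebra 2) S.X, Finite N → N = ⊥ :=
  TowerHaMa.SelmerDualData.forall_finite_eq_bot_of_casselsTateLayerPairing_of_stationary W κ hCT hγ
    (fun P hP ↦ (X5.O1.irr_two_iff_forall_two_nsmul W).mp (P2.irr_two_of_goodSS_two W hss) P (by convert hP)) S hst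

/-! ### §2 ★★ The hand h11: the memo signature VERBATIM behind the two print binders -/

/-- ★★ **HAND h11 «CLASSICAL NF AT GOOD SUPERSINGULAR 2», modulo (hCT) and (hKR).** Conclusion = LEAD ss-1 GEN 23's signature
`classicalNoFiniteSubmodule_goodSS_two` VERBATIM (= binder `hA` of `OddBlindNF.flatNoFiniteSubmoduleAtTwo_of_classical`): for every globally
minimal elliptic `W/ℚ` good supersingular at `2`, cyclotomic `κ` with topological generator `γ` matching the cyclotomic variable, and every
f.g. dual datum `S`, `X(E/ℚ_∞) = S.X` has no non-zero finite `Λ`-submodule — GRANTED the two PRINT inputs as leading binders: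
(hCT) the Cassels–Tate pairing on the layers `Sel_{2^∞}(E/ℚ_n)` (alternating, kernel = divisible elements, Galois-equivariant, res ⊣ cor:
Literature named fact `HachimoriMatsuno2000.casselsTate_layerPairing`, Cassels 1962 / Silverman X.4.14 / Milne ADT I 6.13 / Fisher 2003
Prop. 2.16); (hKR) «`corank_{ℤ₂} Sel_{2^∞}(E/ℚ_n)` bounded along the cyclotomic `ℤ₂`-tower» for such `W` (Kato 2004 Thm. 14.2 (2) / Cor. 14.3
with Rohrlich 1984: the `χ`-parts for the cofinitely many `χ` with `L(E, χ, 1) ≠ 0` are finite, the finitely many exceptional `χ`-parts have corank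
bounded by `corank Sel_{2^∞}(E/ℚ_{n₀})`; no claim about finiteness of `Ш`). Everything else — injective layers from `E(ℚ)[2] = 0` (automatic
at good supersingular `2`), transitions, exhaustion, `Γ`-action, kernel corestriction and norm relation, divisible parts as right kernels,
finiteness of `Sel_n/D_n`, `#D_n[2] = 2^{corank}`, the stationarity, and Hachimori–Matsuno's norm argument — is kernel
(this seat GEN 21/22/63 + cell `bsd-potss`). Expected use: slot 4 NF♭ of line `odd_blind_package` via `…_of_classical (hA := this hCT hKR)`.
[cite: HachimoriMatsuno2000, Theorem and Corollary (i), proof p. 2540 L28–L45] [cite: Matsuno2003, Prop. 4.1]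
[cite: KitajimaOtsuki2018, Prop. 4.4, Thm. 4.5 (arXiv:1607.03612 p. 18)] [cite: Kato2004Asterisque, Thm. 14.2, Cor. 14.3 (pp. 235–236)] -/
theorem classicalNoFiniteSubmodule_goodSS_two_of_casselsTateLayerPairing_of_corankBounded
    (hCT : HachimoriMatsuno2000.casselsTate_layerPairing.{0})
    (hKR : ∀ (W : WeierstrassCurve ℚ) [W.IsElliptic] [W.IsGloballyMinimal], GoodSS W 2 →
      ∀ (κ : ZpExtension ℚ 2), κ.IsCyclotomic → ∃ B : ℕ, ∀ n : ℕ, zpCorank (W.selmerLayer κ n) 2 ≤ B) :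
    ∀ (W : WeierstrassCurve ℚ) [W.IsElliptic] [W.IsGloballyMinimal], GoodSS W 2 →
      ∀ (κ : ZpExtension ℚ 2) (γ : Field.absoluteGaloisGroup ℚ),
        κ.IsCyclotomic → κ.IsTopGenerator γ → IsCyclotomicVariable 2 γ →
      ∀ (S : W.SelmerDualData κ γ) [Module.Finite (IwasawaAlgebra 2) S.X],
        ∀ N : Submodule (IwasawaAlgebra 2) S.X, Finite N → N = ⊥ := by
  intro W _ _ hss κ γ hκ hγ _ S _ N hN
  exact classicalNoFiniteSubmodule_of_goodSS_two_of_casselsTateLayerPairing_of_corankBounded hCT W hss κ γ hγ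
    (hKR W hss κ hκ) S N hN

/-- **HAND h11 with the weakest growth input**: the memo signature VERBATIM behind (hCT) and (hST) = «for every globally minimal elliptic
`W/ℚ` good supersingular at `2` and every cyclotomic `κ`, the images of the divisible parts `Sel_{2^∞}(E/ℚ_n)_{div}` in `H¹(ℚ_∞, E[2^∞])`
are stationary» (implied by (hKR) in the kernel, `…TowerNoFiniteSubmoduleOfCorankBounded` §2).
[cite: HachimoriMatsuno2000, Theorem and Corollary (i), proof p. 2540 L28–L45] -/
theorem classicalNoFiniteSubmodule_goodSS_two_of_casselsTateLayerPairing_of_stationary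
    (hCT : HachimoriMatsuno2000.casselsTate_layerPairing.{0})
    (hST : ∀ (W : WeierstrassCurve ℚ) [W.IsElliptic] [W.IsGloballyMinimal], GoodSS W 2 →
      ∀ (κ : ZpExtension ℚ 2), κ.IsCyclotomic →
      ∃ m : ℕ, ∀ n, m ≤ n → ∀ d ∈ AddSubgroup.divisibleElements (W.selmerLayer κ (n + 1)),
        ∃ d₀ ∈ AddSubgroup.divisibleElements (W.selmerLayer κ n),
          W.layerToInfty κ (n + 1) (d : W.subgroupH1 2 (κ.layerSubgroup (n + 1))) = W.layerToInfty κ n d₀) :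
    ∀ (W : WeierstrassCurve ℚ) [W.IsElliptic] [W.IsGloballyMinimal], GoodSS W 2 →
      ∀ (κ : ZpExtension ℚ 2) (γ : Field.absoluteGaloisGroup ℚ),
        κ.IsCyclotomic → κ.IsTopGenerator γ → IsCyclotomicVariable 2 γ →
      ∀ (S : W.SelmerDualData κ γ) [Module.Finite (IwasawaAlgebra 2) S.X],
        ∀ N : Submodule (IwasawaAlgebra 2) S.X, Finite N → N = ⊥ := by
  intro W _ _ hss κ γ hκ hγ _ S _ N hN
  exact classicalNoFiniteSubmodule_of_goodSS_two_of_casselsTateLayerPairing_of_stationary hCT W hss κ γ hγ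
    (hST W hss κ hκ) S N hN

end OddBlindNF

end Summit.BirchSwinnertonDyer.BirchSwinnertonDyer.Theorems

end
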